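import Summits.AtomisticToContinuum.HydrodynamicLimit.Theorems.EnskogAdjointDualityAdjointEnskogTestFamilyRKernelDelocPrep
import HarnessLib

/-!
# K2R refutation line: the delocalisation kernel `g(E)/√E` against `(π/2) ϑ_R(E)` (stub `kernelDeloc`)

Route `EnskogAdjointDuality` of `AtomisticToContinuum/HydrodynamicLimit`, crux `AdjointEnskogTestFamilyR`
(stmt-AtomisticToContinuum-11592, "K2R"), line `refutation`, stub `stub_kernelDeloc` (file 2 of 2).

With the critical isotropic weight `ϑ_R(E) = (1+E)⁻³ e^{-E/R}` (energy `E = |U|²`), its tail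
`Θ̄_R(x) = ∫_x^∞ ϑ_R` and a continuous `h` with `h(a) - h(-a) = a`, the first angular moment
`g(E) = π ∫_{-1}^{1} t e^{-E(1-t²)/2} h(√E t) Θ̄_R(E t²) dt` (which governs the Enskog
delocalisation term of the dual gain kernel) satisfies
`∫₀^∞ (1+E) E |g(E)/√E - (π/2) ϑ_R(E)| dE ≤ M₂` with `M₂ = 16898 π` independent of `R ≥ 1`.

Proof.  (1) Antisymmetry of `h` folds `(-1,1)` onto `(0,1)`:
`g(E) = π √E ∫₀¹ t² e^{-E(1-t²)/2} Θ̄_R(E t²) dt` (`k2r_ref_K2_antisym`).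
(2) One integration by parts in `t` (`d/dt e^{-E(1-t²)/2} = E t e^{-E(1-t²)/2}`) gives
`∫₀¹ t² e^{-E(1-t²)/2} Θ̄(E t²) dt = Θ̄(E)/E - (1/E) ∫₀¹ [Θ̄(Et²) - 2Et² ϑ(Et²)] e^{-E(1-t²)/2} dt`
with remainder `≤ 16896 (1+E)⁻³/E` (`k2r_ref_K2_ibp`, from the Prep file's pointwise bound).
(3) The exact tail identity `Θ̄_R(E) = ½ (1+E)⁻² e^{-E/R} - (2R)⁻¹ T_R(E)`,
`T_R(E) ≤ (1+E)⁻¹ e^{-E/R}` (Prep file) gives `Θ̄(E)/E - ϑ(E)/2 = (ϑ(E) - R⁻¹ T_R(E)) / (2E)`,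
whence the weighted error is dominated by `π (16897 (1+E)⁻² + R⁻¹ e^{-E/R})`, of integral `16898 π`
(`k2r_ref_K2_alg`, `k2r_ref_K2_majorant`, `k2r_ref_K2_main`).  Measurability comes from the
continuous surrogate `Θ̃` of `Θ̄_R` and joint continuity of the parametric integrand.

References: elementary real analysis [folklore].
-/

noncomputable section

open MeasureTheory Set Filter Topology
open scoped Real

namespace Summit.AtomisticToContinuum.HydrodynamicLimit.Theorems.EnskogAdjointDuality

/-! ## Integration by parts in `t`, antisymmetry fold, assembly -/

/-- **The integration by parts.** For `Θ̃' = -ϑ⁺` (continuous) with `0 ≤ Θ̃ ≤ ½(1+x)⁻²`,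
`0 ≤ ϑ⁺ ≤ (1+x)⁻³` on `[0,∞)` and `E > 0`:
`|∫₀¹ t² e^{-E(1-t²)/2} Θ̃(Et²) dt - Θ̃(E)/E| ≤ 16896 (1+E)⁻³ / E`. [folklore] -/
theorem k2r_ref_K2_ibp {Θt ϑp : ℝ → ℝ} (hΘc : Continuous Θt) (hϑc : Continuous ϑp)
    (hd : ∀ x, HasDerivAt Θt (-ϑp x) x)
    (hΘb : ∀ x, 0 ≤ x → 0 ≤ Θt x ∧ Θt x ≤ 1 / 2 * ((1 + x) ^ 2)⁻¹)
    (hϑb : ∀ x, 0 ≤ x → 0 ≤ ϑp x ∧ ϑp x ≤ ((1 + x) ^ 3)⁻¹) {E : ℝ} (hE : 0 < E) :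
    |(∫ t in (0 : ℝ)..1, (t * Θt (E * t ^ 2)) * (t * Real.exp (-(E * (1 - t ^ 2)) / 2))) - Θt E / E|
      ≤ 16896 * ((1 + E) ^ 3)⁻¹ / E := by
  have hu : ∀ t ∈ uIcc (0 : ℝ) 1, HasDerivAt (fun t : ℝ => t * Θt (E * t ^ 2))
      (Θt (E * t ^ 2) - 2 * E * t ^ 2 * ϑp (E * t ^ 2)) t := by
    intro t _
    have h1 : HasDerivAt (fun t : ℝ => E * t ^ 2) (E * (2 * t)) t :=
      ((hasDerivAt_pow 2 t).const_mul E).congr_deriv (by simp)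
    refine ((hasDerivAt_id' t).fun_mul ((hd (E * t ^ 2)).comp t h1)).congr_deriv ?_
    simp only [Function.comp]; ring
  have hv : ∀ t ∈ uIcc (0 : ℝ) 1, HasDerivAt (fun t : ℝ => Real.exp (-(E * (1 - t ^ 2)) / 2) / E)
      (t * Real.exp (-(E * (1 - t ^ 2)) / 2)) t := by
    intro t _
    have h1 : HasDerivAt (fun t : ℝ => -(E * (1 - t ^ 2)) / 2) (E * t) t := by
      refine ((((hasDerivAt_const t (1 : ℝ)).fun_sub (hasDerivAt_pow 2 t)).const_mul E).fun_neg.div_const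
        2).congr_deriv ?_
      simp; ring
    refine (h1.exp.div_const E).congr_deriv ?_
    field_simp
  have hu'c : Continuous fun t : ℝ => Θt (E * t ^ 2) - 2 * E * t ^ 2 * ϑp (E * t ^ 2) := by
    fun_prop
  have hv'c : Continuous fun t : ℝ => t * Real.exp (-(E * (1 - t ^ 2)) / 2) := by fun_prop
  have hibp := intervalIntegral.integral_mul_deriv_eq_deriv_mul hu hv (hu'c.intervalIntegrable 0 1)
    (hv'c.intervalIntegrable 0 1)
  have hrem : (∫ t in (0 : ℝ)..1, (t * Θt (E * t ^ 2)) * (t * Real.exp (-(E * (1 - t ^ 2)) / 2)))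
      - Θt E / E = -∫ t in (0 : ℝ)..1, (Θt (E * t ^ 2) - 2 * E * t ^ 2 * ϑp (E * t ^ 2))
        * (Real.exp (-(E * (1 - t ^ 2)) / 2) / E) := by
    rw [hibp]; simp; ring
  rw [hrem, abs_neg]
  have hpt : ∀ t ∈ Ioc (0 : ℝ) 1, ‖(Θt (E * t ^ 2) - 2 * E * t ^ 2 * ϑp (E * t ^ 2))
      * (Real.exp (-(E * (1 - t ^ 2)) / 2) / E)‖
        ≤ 1056 * ((1 + E) ^ 2)⁻¹ / E * Real.exp (-(E * (1 - t)) / 8) := by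
    intro t ht
    have hs : 0 ≤ E * t ^ 2 := by positivity
    rw [Real.norm_eq_abs]
    exact k2r_ref_K2_pointwise hE ht.1.le ht.2 (hΘb _ hs).1 (hΘb _ hs).2 (hϑb _ hs).1 (hϑb _ hs).2
  have hE1 : 0 < 1 + E := by linarith
  calc |∫ t in (0 : ℝ)..1, (Θt (E * t ^ 2) - 2 * E * t ^ 2 * ϑp (E * t ^ 2))
          * (Real.exp (-(E * (1 - t ^ 2)) / 2) / E)|
      ≤ ∫ t in (0 : ℝ)..1, 1056 * ((1 + E) ^ 2)⁻¹ / E * Real.exp (-(E * (1 - t)) / 8) := by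
        have hbc : Continuous fun t : ℝ => 1056 * ((1 + E) ^ 2)⁻¹ / E * Real.exp (-(E * (1 - t)) / 8) := by
          fun_prop
        have := intervalIntegral.norm_integral_le_of_norm_le (μ := volume) zero_le_one
          (Eventually.of_forall hpt) (hbc.intervalIntegrable 0 1)
        simpa only [Real.norm_eq_abs] using this
    _ = 1056 * ((1 + E) ^ 2)⁻¹ / E * ∫ t in (0 : ℝ)..1, Real.exp (-(E * (1 - t)) / 8) :=
        intervalIntegral.integral_const_mul _ _
    _ ≤ 1056 * ((1 + E) ^ 2)⁻¹ / E * (16 / (1 + E)) := by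
        gcongr; exact k2r_ref_K2_J hE
    _ = 16896 * ((1 + E) ^ 3)⁻¹ / E := by field_simp; ring

/-- **Antisymmetry fold.** If `h(a) - h(-a) = a` then
`∫_{-1}^{1} t e^{-E(1-t²)/2} h(√E t) Θ̃(Et²) dt = √E ∫₀¹ t² e^{-E(1-t²)/2} Θ̃(Et²) dt`. [folklore] -/
theorem k2r_ref_K2_antisym {h Θt : ℝ → ℝ} (hh : Continuous h) (hanti : ∀ a, h a - h (-a) = a)
    (hΘc : Continuous Θt) (E : ℝ) :
    ∫ t in (-1 : ℝ)..1, t * Real.exp (-(E * (1 - t ^ 2)) / 2) * h (Real.sqrt E * t) * Θt (E * t ^ 2)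
      = Real.sqrt E * ∫ t in (0 : ℝ)..1,
          (t * Θt (E * t ^ 2)) * (t * Real.exp (-(E * (1 - t ^ 2)) / 2)) := by
  obtain ⟨f, hf⟩ : ∃ f : ℝ → ℝ,
      f = fun t => t * Real.exp (-(E * (1 - t ^ 2)) / 2) * h (Real.sqrt E * t) * Θt (E * t ^ 2) :=
    ⟨_, rfl⟩
  have hfc : Continuous f := by rw [hf]; fun_prop
  have hfn : Continuous fun t => f (-t) := hfc.comp continuous_neg
  have hfi : ∀ a b : ℝ, IntervalIntegrable f volume a b := fun a b => hfc.intervalIntegrable a b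
  rw [show (fun t : ℝ => t * Real.exp (-(E * (1 - t ^ 2)) / 2) * h (Real.sqrt E * t) * Θt (E * t ^ 2))
      = f from hf.symm, ← intervalIntegral.integral_add_adjacent_intervals (hfi (-1) 0) (hfi 0 1)]
  have hneg : ∫ t in (-1 : ℝ)..0, f t = ∫ t in (0 : ℝ)..1, f (-t) := by
    rw [intervalIntegral.integral_comp_neg]; norm_num
  rw [hneg, ← intervalIntegral.integral_add (hfn.intervalIntegrable 0 1) (hfi 0 1),
    ← intervalIntegral.integral_const_mul]
  refine intervalIntegral.integral_congr fun t _ => ?_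
  have key := hanti (Real.sqrt E * t)
  simp only [hf, neg_pow_two, mul_neg] at key ⊢
  linear_combination (t * Real.exp (-(E * (1 - t ^ 2)) / 2) * Θt (E * t ^ 2)) * key

/-! ## Assembly -/

/-- **The final algebra.** From `I = Θ/E - K`, `|K| ≤ 16896 (1+E)⁻³/E`,
`Θ = ½(1+E)⁻²e^{-E/R} - (2R)⁻¹ T`, `0 ≤ T ≤ (1+E)⁻¹ e^{-E/R}` (`E > 0`, `R ≥ 1`):
`(1+E) E |π I - (π/2) ϑ_R(E)| ≤ π (16897 (1+E)⁻² + R⁻¹ e^{-E/R})`. [folklore] -/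
theorem k2r_ref_K2_alg {E R I K Θ T : ℝ} (hE : 0 < E) (hR : 1 ≤ R)
    (hI : I = Θ / E - K) (hK : |K| ≤ 16896 * ((1 + E) ^ 3)⁻¹ / E)
    (hΘ : Θ = 1 / 2 * (((1 + E) ^ 2)⁻¹ * Real.exp (-E / R)) - (2 * R)⁻¹ * T)
    (hT0 : 0 ≤ T) (hT1 : T ≤ (1 + E)⁻¹ * Real.exp (-E / R)) :
    (1 + E) * E * |Real.pi * I - Real.pi / 2 * (((1 + E) ^ 3)⁻¹ * Real.exp (-E / R))|
      ≤ Real.pi * (16897 * ((1 + E) ^ 2)⁻¹ + R⁻¹ * Real.exp (-E / R)) := by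
  have he0 : 0 < Real.exp (-E / R) := Real.exp_pos _
  have hR0 : 0 < R := by linarith
  have he1 : Real.exp (-E / R) ≤ 1 := by
    rw [Real.exp_le_one_iff, neg_div]; exact neg_nonpos.2 (by positivity)
  have hE1 : 0 < 1 + E := by linarith
  have hp : ((1 + E) ^ 2)⁻¹ = (1 + E) * ((1 + E) ^ 3)⁻¹ := by field_simp
  have hp2 : 0 < ((1 + E) ^ 2)⁻¹ := by positivity
  have hY : (1 + E) * E * (I - ((1 + E) ^ 3)⁻¹ * Real.exp (-E / R) / 2)
      = ((1 + E) ^ 2)⁻¹ * Real.exp (-E / R) / 2 - (1 + E) * T / (2 * R) - (1 + E) * E * K := by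
    rw [hI, hΘ]; field_simp; ring
  have hKb : (1 + E) * E * |K| ≤ 16896 * ((1 + E) ^ 2)⁻¹ := by
    calc (1 + E) * E * |K| ≤ (1 + E) * E * (16896 * ((1 + E) ^ 3)⁻¹ / E) := by gcongr
      _ = 16896 * ((1 + E) * ((1 + E) ^ 3)⁻¹) := by field_simp
      _ = 16896 * ((1 + E) ^ 2)⁻¹ := by rw [hp]
  have hTb : (1 + E) * T / (2 * R) ≤ Real.exp (-E / R) / (2 * R) := by
    gcongr
    calc (1 + E) * T ≤ (1 + E) * ((1 + E)⁻¹ * Real.exp (-E / R)) := by gcongr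
      _ = Real.exp (-E / R) := by field_simp
  have hTn : 0 ≤ (1 + E) * T / (2 * R) := by positivity
  have habs : |(1 + E) * E * (I - ((1 + E) ^ 3)⁻¹ * Real.exp (-E / R) / 2)|
      ≤ ((1 + E) ^ 2)⁻¹ * Real.exp (-E / R) / 2 + (1 + E) * T / (2 * R) + (1 + E) * E * |K| := by
    rw [hY]
    refine (abs_sub _ _).trans ?_
    rw [abs_mul, abs_of_pos (by positivity : 0 < (1 + E) * E)]
    gcongr
    refine (abs_sub _ _).trans ?_
    rw [abs_of_nonneg (by positivity), abs_of_nonneg hTn]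
  calc (1 + E) * E * |Real.pi * I - Real.pi / 2 * (((1 + E) ^ 3)⁻¹ * Real.exp (-E / R))|
      = Real.pi * |(1 + E) * E * (I - ((1 + E) ^ 3)⁻¹ * Real.exp (-E / R) / 2)| := by
        rw [show Real.pi * I - Real.pi / 2 * (((1 + E) ^ 3)⁻¹ * Real.exp (-E / R))
            = Real.pi * (I - ((1 + E) ^ 3)⁻¹ * Real.exp (-E / R) / 2) by ring, abs_mul, abs_mul,
          abs_of_pos Real.pi_pos, abs_of_pos (by positivity : 0 < (1 + E) * E)]
        ring
    _ ≤ Real.pi * (((1 + E) ^ 2)⁻¹ * Real.exp (-E / R) / 2 + (1 + E) * T / (2 * R)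
          + (1 + E) * E * |K|) := by gcongr
    _ ≤ Real.pi * (((1 + E) ^ 2)⁻¹ * 1 / 2 + Real.exp (-E / R) / (2 * R)
          + 16896 * ((1 + E) ^ 2)⁻¹) := by gcongr
    _ ≤ Real.pi * (16897 * ((1 + E) ^ 2)⁻¹ + R⁻¹ * Real.exp (-E / R)) := by
        refine mul_le_mul_of_nonneg_left ?_ Real.pi_pos.le
        have h2R : Real.exp (-E / R) / (2 * R) ≤ R⁻¹ * Real.exp (-E / R) := by
          rw [div_le_iff₀ (by positivity), mul_comm R⁻¹, mul_assoc, mul_comm (Real.exp _)]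
          have : R⁻¹ * (2 * R) = 2 := by field_simp
          rw [this]; linarith
        nlinarith

/-- The majorant `π (16897 (1+E)⁻² + R⁻¹ e^{-E/R})` is integrable on `(0,∞)` with integral `16898 π`
(`R ≥ 1`). [folklore] -/
theorem k2r_ref_K2_majorant {R : ℝ} (hR : 1 ≤ R) :
    IntegrableOn (fun E : ℝ => Real.pi * (16897 * ((1 + E) ^ 2)⁻¹ + R⁻¹ * Real.exp (-E / R))) (Ioi 0) ∧
    ∫ E in Ioi (0 : ℝ), Real.pi * (16897 * ((1 + E) ^ 2)⁻¹ + R⁻¹ * Real.exp (-E / R))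
      = 16898 * Real.pi := by
  have hR0 : 0 < R := by linarith
  obtain ⟨hp2i, hp2⟩ := k2r_ref_K2_integral_p2 (show (-1 : ℝ) < 0 by norm_num)
  have hexp_eq : (fun E : ℝ => Real.exp (-E / R)) = fun E => Real.exp (-R⁻¹ * E) := by
    funext E; congr 1; ring
  have hei : IntegrableOn (fun E : ℝ => Real.exp (-E / R)) (Ioi 0) := by
    rw [hexp_eq]; exact exp_neg_integrableOn_Ioi 0 (inv_pos.2 hR0)
  have heI : ∫ E in Ioi (0 : ℝ), Real.exp (-E / R) = R := by
    rw [hexp_eq, integral_exp_mul_Ioi (neg_lt_zero.2 (inv_pos.2 hR0)) 0]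
    field_simp
    simp
  refine ⟨((hp2i.const_mul 16897).add (hei.const_mul R⁻¹)).const_mul Real.pi, ?_⟩
  rw [integral_const_mul, integral_add (hp2i.const_mul _) (hei.const_mul _), integral_const_mul,
    integral_const_mul, hp2, heI]
  field_simp
  norm_num

/-- **Main estimate, unfolded form.** For continuous `h` with `h(a) - h(-a) = a` there is `M₂`
(namely `16898 π`) bounding `∫₀^∞ (1+E) E |g(E)/√E - (π/2) ϑ_R(E)| dE` for every `R ≥ 1`, the
integrand being integrable. [folklore] -/
theorem k2r_ref_K2_main (h : ℝ → ℝ) (hh : Continuous h) (hanti : ∀ a, h a - h (-a) = a) :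
    ∃ M₂ : ℝ, ∀ R : ℝ, 1 ≤ R →
      IntegrableOn (fun E : ℝ => (1 + E) * E *
        |(Real.pi * ∫ t in (-1 : ℝ)..1, t * Real.exp (-(E * (1 - t ^ 2)) / 2) * h (Real.sqrt E * t) *
            ∫ y in Set.Ioi (E * t ^ 2), ((1 + y) ^ 3)⁻¹ * Real.exp (-y / R)) / Real.sqrt E
          - Real.pi / 2 * (((1 + E) ^ 3)⁻¹ * Real.exp (-E / R))|) (Set.Ioi 0) ∧
      ∫ E in Set.Ioi (0 : ℝ), (1 + E) * E *
        |(Real.pi * ∫ t in (-1 : ℝ)..1, t * Real.exp (-(E * (1 - t ^ 2)) / 2) * h (Real.sqrt E * t) *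
            ∫ y in Set.Ioi (E * t ^ 2), ((1 + y) ^ 3)⁻¹ * Real.exp (-y / R)) / Real.sqrt E
          - Real.pi / 2 * (((1 + E) ^ 3)⁻¹ * Real.exp (-E / R))| ≤ M₂ := by
  refine ⟨16898 * Real.pi, fun R hR => ?_⟩
  have hR0 : 0 < R := by linarith
  obtain ⟨Θt, ϑp, hΘc, hϑc, hd, hΘeq, hΘb, hϑb⟩ := k2r_ref_K2_theta hR0
  -- the continuous surrogate of the first angular moment and of the integrand
  obtain ⟨G, hG⟩ : ∃ G : ℝ → ℝ, G = fun E => ∫ t in (-1 : ℝ)..1,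
      t * Real.exp (-(E * (1 - t ^ 2)) / 2) * h (Real.sqrt E * t) * Θt (E * t ^ 2) := ⟨_, rfl⟩
  have hGc : Continuous G := by
    rw [hG]
    exact intervalIntegral.continuous_parametric_intervalIntegral_of_continuous' (by fun_prop) (-1) 1
  obtain ⟨Ft, hFt⟩ : ∃ Ft : ℝ → ℝ, Ft = fun E => (1 + E) * E *
      |Real.pi * G E / Real.sqrt E - Real.pi / 2 * (((1 + E) ^ 3)⁻¹ * Real.exp (-E / R))| := ⟨_, rfl⟩
  have hFm : Measurable Ft := by rw [hFt]; fun_prop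
  have hbound : ∀ E ∈ Ioi (0 : ℝ),
      Ft E ≤ Real.pi * (16897 * ((1 + E) ^ 2)⁻¹ + R⁻¹ * Real.exp (-E / R)) := by
    intro E hE
    have hE' : (0 : ℝ) < E := hE
    obtain ⟨-, -, hclosed, hT0, hT1, -, -⟩ := k2r_ref_K2_tail hR0 hE'.le
    have hibp := k2r_ref_K2_ibp hΘc hϑc hd hΘb hϑb hE'
    have hsq : Real.sqrt E ≠ 0 := (Real.sqrt_pos.2 hE').ne'
    have hquot : Real.pi * G E / Real.sqrt E = Real.pi * ∫ t in (0 : ℝ)..1,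
        (t * Θt (E * t ^ 2)) * (t * Real.exp (-(E * (1 - t ^ 2)) / 2)) := by
      rw [hG]; dsimp only
      rw [k2r_ref_K2_antisym hh hanti hΘc E, mul_div_assoc, mul_div_cancel_left₀ _ hsq]
    rw [hFt]; dsimp only; rw [hquot]
    refine k2r_ref_K2_alg hE' hR (K := Θt E / E - ∫ t in (0 : ℝ)..1,
        (t * Θt (E * t ^ 2)) * (t * Real.exp (-(E * (1 - t ^ 2)) / 2))) (by ring) ?_
      ((hΘeq E hE'.le).trans hclosed) hT0 hT1
    rwa [abs_sub_comm]
  have hFnn : ∀ E ∈ Ioi (0 : ℝ), 0 ≤ Ft E := fun E hE => by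
    have hE' : (0 : ℝ) < E := hE
    rw [hFt]; positivity
  obtain ⟨hBi, hBI⟩ := k2r_ref_K2_majorant hR
  have hFi : IntegrableOn Ft (Ioi 0) := by
    refine Integrable.mono' hBi hFm.aestronglyMeasurable ?_
    exact (ae_restrict_iff' measurableSet_Ioi).2 (Eventually.of_forall fun E hE => by
      rw [Real.norm_eq_abs, abs_of_nonneg (hFnn E hE)]; exact hbound E hE)
  have hFI : ∫ E in Ioi (0 : ℝ), Ft E ≤ 16898 * Real.pi :=
    (setIntegral_mono_on hFi hBi measurableSet_Ioi hbound).trans_eq hBI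
  -- transfer to the original integrand, which agrees with `Ft` on `(0, ∞)`
  suffices H : ∀ F : ℝ → ℝ, EqOn Ft F (Ioi 0) →
      IntegrableOn F (Ioi 0) ∧ ∫ E in Ioi (0 : ℝ), F E ≤ 16898 * Real.pi by
    refine H _ (fun E hE => ?_)
    have hE' : (0 : ℝ) < E := hE
    have hint : (∫ t in (-1 : ℝ)..1, t * Real.exp (-(E * (1 - t ^ 2)) / 2) * h (Real.sqrt E * t) *
        Θt (E * t ^ 2)) = ∫ t in (-1 : ℝ)..1, t * Real.exp (-(E * (1 - t ^ 2)) / 2) *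
          h (Real.sqrt E * t) * ∫ y in Set.Ioi (E * t ^ 2), ((1 + y) ^ 3)⁻¹ * Real.exp (-y / R) :=
      intervalIntegral.integral_congr fun t _ => by rw [hΘeq (E * t ^ 2) (by positivity)]
    rw [hFt, hG]; dsimp only; rw [hint]
  intro F hEq
  exact ⟨hFi.congr_fun hEq measurableSet_Ioi,
    (setIntegral_congr_fun measurableSet_Ioi hEq).symm.trans_le hFI⟩

/-- **Stub `kernelDeloc` of the K2R refutation line** (registered signature). With
`ϑ_R(E) = (1+E)⁻³ e^{-E/R}`, `Θ̄_R(x) = ∫_x^∞ ϑ_R`, a continuous `h` with `h(a) - h(-a) = a` and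
`g(E) = π ∫_{-1}^{1} t e^{-E(1-t²)/2} h(√E t) Θ̄_R(Et²) dt`: there is `M₂` with
`∫₀^∞ (1+E) E |g(E)/√E - (π/2) ϑ_R(E)| dE ≤ M₂` for all `R ≥ 1` (and the integrand is integrable).
[folklore] -/
theorem stub_kernelDeloc :
  let th0 : ℝ → ℝ → ℝ := fun R E => ((1 + E) ^ 3)⁻¹ * Real.exp (-E / R)
  let Tb0 : ℝ → ℝ → ℝ := fun R x => ∫ E in Set.Ioi x, th0 R E
  ∀ h : ℝ → ℝ, Continuous h → (∀ a, 0 ≤ h a - max a 0 ∧ h a - max a 0 ≤ Real.exp (-a ^ 2 / 2)) →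
  (∀ a, h a - h (-a) = a) →
  ∃ M₂ : ℝ, ∀ R : ℝ, 1 ≤ R →
    let g : ℝ → ℝ := fun E => Real.pi * ∫ t in (-1 : ℝ)..1,
      t * Real.exp (-(E * (1 - t ^ 2)) / 2) * h (Real.sqrt E * t) * Tb0 R (E * t ^ 2)
    IntegrableOn (fun E => (1 + E) * E * |g E / Real.sqrt E - Real.pi / 2 * th0 R E|) (Set.Ioi 0) ∧
    ∫ E in Set.Ioi (0 : ℝ), (1 + E) * E * |g E / Real.sqrt E - Real.pi / 2 * th0 R E| ≤ M₂ := by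
  intro th0 Tb0 h hh _ hanti
  exact k2r_ref_K2_main h hh hanti

end Summit.AtomisticToContinuum.HydrodynamicLimit.Theorems.EnskogAdjointDuality
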